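import Literature.Computability.AlgebraicComplexity.MignonRessayreBound
import Mathlib.Analysis.Complex.Basic

/-!
# `DetqpThesis` (stmt-ValiantsHypothesis-0315), line `Sketch` (idea four-dimensional-determinant) —
# stub T1b: the Hessian sum of `HD_n` at the diagonal block point collapses to the permanent

Write `HD_n = ∑_{σ : Fin 4 → 𝔖_n} (∏_j sgn σ_j) ∏_i x_{σ₀ i, σ₁ i, σ₂ i, σ₃ i}` for the generic
four-dimensional Cayley hyperdeterminant.  Its Hessian entry `∂_I ∂_J HD_n` at a point `x` is the
finite sum over `σ` and over ordered pairs of positions `p ≠ q` carrying `x_I` and `x_J` of the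
product of the remaining `n - 2` coordinates (stub T1a, another file).  This file evaluates that
sum at the *diagonal block point* `A(K) = [K 2 = K 0] [K 3 = K 1] · Y (K 0, K 1)` of a matrix
point `Y` (`stub_hdBlockEmb_sum_eq`):

`∑_σ (∏_j sgn σ_j) ∑_{p ≠ q, σ·p = I, σ·q = J} ∏_{i ∉ {p,q}} A(σ·i)
   = n! · ε(I, J) · Hess(per_n)(Y)[(I 0, I 1), (J 0, J 1)]`,

where `ε(I, J) = ε₂ ε₃ ∈ {0, ±1}`, `ε₂ = 1` if `I 2 = I 0 ∧ J 2 = J 0`, `ε₂ = -1` if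
`I 2 = J 0 ∧ J 2 = I 0`, `ε₂ = 0` otherwise, and likewise `ε₃` on the slots `3 / 1`; the Hessian
entry of the permanent is the explicit `(n-2)`-sub-permanent sum `hess0_transl_perPoly`.

Proof.  A term `(σ, p, q)` survives only if every factor off `{p, q}` is diagonal, i.e.
`σ₂ = σ₀` and `σ₃ = σ₁` off `{p, q}`; a permutation agreeing with `σ₀` off a pair `{p, q}` is
`σ₀` or `swap (σ₀ p) (σ₀ q) * σ₀` (`hdBlockEmb_perm_agree_off_pair`), which forces the
diagonal-or-swapped pattern of `I, J` on the slots `2 / 0` and `3 / 1` and the signs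
`sgn σ₂ = ε₂ sgn σ₀`, `sgn σ₃ = ε₃ sgn σ₁`.  The surviving terms are therefore the image of the
injection `(τ, π) ↦ ((π τ, τ, ρ₂ π τ, ρ₃ τ), τ⁻¹ (I 1), τ⁻¹ (J 1))` (`ρ₂ = 1` or
`swap (I 0) (J 0)`, `ρ₃ = 1` or `swap (I 1) (J 1)`), on which the term equals
`ε₂ ε₃ ∏_{c ∉ {I 1, J 1}} Y (π c, c)` when `π (I 1) = I 0`, `π (J 1) = J 0`, `I 1 ≠ J 1` and `0`
otherwise (`Fintype.sum_of_injective`); summing the `τ`-independent result over `τ ∈ 𝔖_n`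
gives the factor `n!`.

Sources: A. Cayley (1845); L. Gurvits, *Classical complexity and quantum entanglement*, JCSS 69
(2004), Ex. 3.3 (the block embedding); T. Mignon, N. Ressayre (2004), §3 (the Hessian of the
permanent).  Not here: the calculus step T1a and the rank of the resulting pattern matrix (T2).
-/

noncomputable section

-- single-conjunct layout: Sub = Summit, duplicated namespace component intended
set_option linter.dupNamespace false

namespace Summit.ValiantsHypothesis.ValiantsHypothesis.Theorems.DetQPDetqpThesis

open Literature.Computability.AlgebraicComplexity MvPolynomial

section PermPair

variable {α : Type*} [DecidableEq α]

/-- **Permutations agreeing off a pair.**  If two permutations `τ, σ` agree outside `{p, q}`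
(`p ≠ q`), then either `τ = σ`, or `τ` is `σ` followed by the transposition of `σ p, σ q`; the two
cases are told apart by the values at `p, q`. [folklore] -/
theorem hdBlockEmb_perm_agree_off_pair {σ τ : Equiv.Perm α} {p q : α} (hpq : p ≠ q)
    (h : ∀ i, i ≠ p → i ≠ q → τ i = σ i) :
    (τ p = σ p ∧ τ q = σ q ∧ τ = σ) ∨
      (τ p = σ q ∧ τ q = σ p ∧ τ = Equiv.swap (σ p) (σ q) * σ) := by
  have key : ∀ r, (r = p ∨ r = q) → (τ r = σ p ∨ τ r = σ q) := by
    intro r hr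
    by_contra hcon
    obtain ⟨hc1, hc2⟩ := not_or.mp hcon
    set i := σ.symm (τ r) with hi
    have hip : i ≠ p := fun h' => hc1 (by rw [← h', hi, Equiv.apply_symm_apply])
    have hiq : i ≠ q := fun h' => hc2 (by rw [← h', hi, Equiv.apply_symm_apply])
    have hir : i = r := τ.injective (by rw [h i hip hiq, hi, Equiv.apply_symm_apply])
    rcases hr with hr | hr
    · exact hip (hir.trans hr)
    · exact hiq (hir.trans hr)
  have hτpq : τ p ≠ τ q := fun h' => hpq (τ.injective h')
  rcases key p (Or.inl rfl) with hp | hp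
  · have hq : τ q = σ q := by
      rcases key q (Or.inr rfl) with hq | hq
      · exact absurd (hp.trans hq.symm) hτpq
      · exact hq
    refine Or.inl ⟨hp, hq, Equiv.ext fun i => ?_⟩
    by_cases hip : i = p
    · rw [hip, hp]
    by_cases hiq : i = q
    · rw [hiq, hq]
    exact h i hip hiq
  · have hq : τ q = σ p := by
      rcases key q (Or.inr rfl) with hq | hq
      · exact hq
      · exact absurd (hp.trans hq.symm) hτpq
    refine Or.inr ⟨hp, hq, Equiv.ext fun i => ?_⟩
    rw [Equiv.Perm.mul_apply]
    by_cases hip : i = p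
    · rw [hip, hp, Equiv.swap_apply_left]
    by_cases hiq : i = q
    · rw [hiq, hq, Equiv.swap_apply_right]
    rw [h i hip hiq, Equiv.swap_apply_of_ne_of_ne]
    · exact fun h' => hip (σ.injective h')
    · exact fun h' => hiq (σ.injective h')

/-- The correction permutation `ρ = [a' = a] · 1 + [a' ≠ a] · swap a b` fixes every point other
than `a, b`. [folklore] -/
theorem hdBlockEmb_rho_apply_of_ne {a b a' c : α} (hca : c ≠ a) (hcb : c ≠ b) :
    (if a' = a then (1 : Equiv.Perm α) else Equiv.swap a b) c = c := by
  split_ifs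
  · rfl
  · exact Equiv.swap_apply_of_ne_of_ne hca hcb

/-- For `a ≠ b`, the pair `(a', b')` is `(a, b)` or `(b, a)` iff it is the image of `(a, b)` under
the correction permutation `ρ = [a' = a] · 1 + [a' ≠ a] · swap a b`. [folklore] -/
theorem hdBlockEmb_rho_iff {a b a' b' : α} (hab : a ≠ b) :
    ((a' = a ∧ b' = b) ∨ (a' = b ∧ b' = a)) ↔
      ((if a' = a then (1 : Equiv.Perm α) else Equiv.swap a b) a = a' ∧
        (if a' = a then (1 : Equiv.Perm α) else Equiv.swap a b) b = b') := by
  split_ifs with h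
  · rw [Equiv.Perm.one_apply, Equiv.Perm.one_apply]
    constructor
    · rintro (⟨-, h2⟩ | ⟨h1, -⟩)
      · exact ⟨h.symm, h2.symm⟩
      · exact absurd (h.symm.trans h1) hab
    · rintro ⟨-, h2⟩
      exact Or.inl ⟨h, h2.symm⟩
  · rw [Equiv.swap_apply_left, Equiv.swap_apply_right]
    constructor
    · rintro (⟨h1, -⟩ | ⟨h1, h2⟩)
      · exact absurd h1 h
      · exact ⟨h1.symm, h2.symm⟩
    · rintro ⟨h1, h2⟩
      exact Or.inr ⟨h1.symm, h2.symm⟩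

/-- The sign of the correction permutation `ρ = [a' = a] · 1 + [a' ≠ a] · swap a b` (`a ≠ b`),
as a complex number, is `[a' = a] - [a' ≠ a]`. [folklore] -/
theorem hdBlockEmb_sign_rho [Fintype α] {a b a' : α} (hab : a ≠ b) :
    ((Equiv.Perm.sign (if a' = a then (1 : Equiv.Perm α) else Equiv.swap a b) : ℤˣ) : ℂ) =
      if a' = a then 1 else -1 := by
  split_ifs
  · rw [Equiv.Perm.sign_one, Units.val_one, Int.cast_one]
  · rw [Equiv.Perm.sign_swap hab, Units.val_neg, Units.val_one, Int.cast_neg, Int.cast_one]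

/-- `sgn(τ)² = 1` in `ℂ`. [folklore] -/
theorem hdBlockEmb_sign_mul_self [Fintype α] (τ : Equiv.Perm α) :
    ((Equiv.Perm.sign τ : ℤˣ) : ℂ) * ((Equiv.Perm.sign τ : ℤˣ) : ℂ) = 1 := by
  rw [← Int.cast_mul, ← Units.val_mul, Int.units_mul_self, Units.val_one, Int.cast_one]

end PermPair

/-! ### The surviving terms and their values -/

/-- The reindexing map `(τ, π) ↦ ((π τ, τ, ρ₂ π τ, ρ₃ τ), τ⁻¹ (I 1), τ⁻¹ (J 1))` of the surviving
terms is injective (read off `τ` and `π τ` from the slots `1, 0`). [folklore] -/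
theorem hdBlockEmb_inj (n : ℕ) (I J : Fin 4 → Fin n) :
    Function.Injective (fun y : Equiv.Perm (Fin n) × Equiv.Perm (Fin n) =>
      ((![y.2 * y.1, y.1, (if I 2 = I 0 then 1 else Equiv.swap (I 0) (J 0)) * (y.2 * y.1),
          (if I 3 = I 1 then 1 else Equiv.swap (I 1) (J 1)) * y.1] : Fin 4 → Equiv.Perm (Fin n)),
        y.1.symm (I 1), y.1.symm (J 1))) := by
  intro y y' h
  have h0 := congrArg (fun z => z.1 0) h
  have h1 := congrArg (fun z => z.1 1) h
  simp only [Matrix.cons_val_zero, Matrix.cons_val_one] at h0 h1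
  refine Prod.ext h1 ?_
  rw [h1] at h0
  exact mul_right_cancel h0

/-- **Off the image the term vanishes.**  If the term of `(σ, p, q)` at the diagonal block point
is nonzero then `p ≠ q`, `σ·p = I`, `σ·q = J` and every factor off `{p, q}` is diagonal, so
`σ₂` agrees with `σ₀` and `σ₃` with `σ₁` off `{p, q}`; by `hdBlockEmb_perm_agree_off_pair`
`σ₂ = ρ₂ σ₀`, `σ₃ = ρ₃ σ₁`, and `(σ, p, q)` is the image of `(σ₁, σ₀ σ₁⁻¹)`. [folklore] -/
theorem hdBlockEmb_vanish (n : ℕ) (Y : Fin n × Fin n → ℂ) (I J : Fin 4 → Fin n)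
    (σ : Fin 4 → Equiv.Perm (Fin n)) (p q : Fin n)
    (hσ : (σ, p, q) ∉ Set.range (fun y : Equiv.Perm (Fin n) × Equiv.Perm (Fin n) =>
      ((![y.2 * y.1, y.1, (if I 2 = I 0 then 1 else Equiv.swap (I 0) (J 0)) * (y.2 * y.1),
          (if I 3 = I 1 then 1 else Equiv.swap (I 1) (J 1)) * y.1] : Fin 4 → Equiv.Perm (Fin n)),
        y.1.symm (I 1), y.1.symm (J 1)))) :
    (∏ j, (Equiv.Perm.sign (σ j) : ℂ)) *
        (if p ≠ q ∧ (fun j => σ j p) = I ∧ (fun j => σ j q) = J then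
          ∏ i ∈ (Finset.univ.erase p).erase q,
            (if σ 2 i = σ 0 i ∧ σ 3 i = σ 1 i then Y (σ 0 i, σ 1 i) else 0)
        else 0) = 0 := by
  by_cases hP : p ≠ q ∧ (fun j => σ j p) = I ∧ (fun j => σ j q) = J
  swap
  · rw [if_neg hP, mul_zero]
  rw [if_pos hP]
  obtain ⟨hpq, hI, hJ⟩ := hP
  have hI' : ∀ j, σ j p = I j := fun j => congrFun hI j
  have hJ' : ∀ j, σ j q = J j := fun j => congrFun hJ j
  by_cases hprod : ∃ i, i ≠ p ∧ i ≠ q ∧ ¬(σ 2 i = σ 0 i ∧ σ 3 i = σ 1 i)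
  · obtain ⟨i, hip, hiq, hi⟩ := hprod
    rw [Finset.prod_eq_zero (i := i)
      (Finset.mem_erase.mpr ⟨hiq, Finset.mem_erase.mpr ⟨hip, Finset.mem_univ i⟩⟩) (if_neg hi),
      mul_zero]
  have hoff : ∀ i, i ≠ p → i ≠ q → (σ 2 i = σ 0 i ∧ σ 3 i = σ 1 i) := fun i hip hiq => by
    by_contra hi
    exact hprod ⟨i, hip, hiq, hi⟩
  exfalso
  apply hσ
  have h01 : I 0 ≠ J 0 := fun h => hpq ((σ 0).injective (by rw [hI' 0, hJ' 0, h]))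
  have h11 : I 1 ≠ J 1 := fun h => hpq ((σ 1).injective (by rw [hI' 1, hJ' 1, h]))
  have h2 : σ 2 = (if I 2 = I 0 then 1 else Equiv.swap (I 0) (J 0)) * σ 0 := by
    rcases hdBlockEmb_perm_agree_off_pair hpq (fun i hip hiq => (hoff i hip hiq).1) with
      ⟨hp2, -, he⟩ | ⟨hp2, -, he⟩
    · rw [hI' 2, hI' 0] at hp2
      rw [if_pos hp2, one_mul, he]
    · rw [hI' 2, hJ' 0] at hp2
      have h20 : I 2 ≠ I 0 := fun h => h01 (h.symm.trans hp2)
      rw [if_neg h20, he, hI' 0, hJ' 0]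
  have h3 : σ 3 = (if I 3 = I 1 then 1 else Equiv.swap (I 1) (J 1)) * σ 1 := by
    rcases hdBlockEmb_perm_agree_off_pair hpq (fun i hip hiq => (hoff i hip hiq).2) with
      ⟨hp3, -, he⟩ | ⟨hp3, -, he⟩
    · rw [hI' 3, hI' 1] at hp3
      rw [if_pos hp3, one_mul, he]
    · rw [hI' 3, hJ' 1] at hp3
      have h31 : I 3 ≠ I 1 := fun h => h11 (h.symm.trans hp3)
      rw [if_neg h31, he, hI' 1, hJ' 1]
  refine ⟨(σ 1, σ 0 * (σ 1)⁻¹), ?_⟩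
  simp only [Prod.mk.injEq]
  refine ⟨funext fun j => ?_, (Equiv.symm_apply_eq _).mpr (hI' 1).symm,
    (Equiv.symm_apply_eq _).mpr (hJ' 1).symm⟩
  fin_cases j
  · simp
  · simp
  · simp [h2]
  · simp [h3]

/-- **On the image the term is the permanent term.**  At `σ = (π τ, τ, ρ₂ π τ, ρ₃ τ)`,
`p = τ⁻¹ (I 1)`, `q = τ⁻¹ (J 1)` the constraints `σ·p = I`, `σ·q = J` read `π (I 1) = I 0`,
`π (J 1) = J 0` plus the diagonal-or-swapped pattern `ε(I, J) ≠ 0` (`hdBlockEmb_rho_iff`), the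
sign is `∏_j sgn σ_j = sgn ρ₂ · sgn ρ₃ = ε₂ ε₃` (`hdBlockEmb_sign_rho`), every factor off
`{p, q}` is diagonal (`hdBlockEmb_rho_apply_of_ne`) and the product reindexes by `c = τ i` to
`∏_{c ∉ {I 1, J 1}} Y (π c, c)` (`Finset.prod_equiv`). [folklore] -/
theorem hdBlockEmb_agree (n : ℕ) (Y : Fin n × Fin n → ℂ) (I J : Fin 4 → Fin n)
    (τ π : Equiv.Perm (Fin n)) (σ : Fin 4 → Equiv.Perm (Fin n))
    (h0 : σ 0 = π * τ) (h1 : σ 1 = τ)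
    (h2 : σ 2 = (if I 2 = I 0 then 1 else Equiv.swap (I 0) (J 0)) * (π * τ))
    (h3 : σ 3 = (if I 3 = I 1 then 1 else Equiv.swap (I 1) (J 1)) * τ) :
    (if ((I 2 = I 0 ∧ J 2 = J 0) ∨ (I 2 = J 0 ∧ J 2 = I 0)) ∧
          ((I 3 = I 1 ∧ J 3 = J 1) ∨ (I 3 = J 1 ∧ J 3 = I 1))
        then (if I 2 = I 0 then (1 : ℂ) else -1) * (if I 3 = I 1 then 1 else -1) else 0) *
      (if π (J 1) = J 0 ∧ I 1 ≠ J 1 ∧ π (I 1) = I 0 then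
        ∏ i ∈ (Finset.univ.erase (J 1)).erase (I 1), Y (π i, i) else 0) =
    (∏ j, (Equiv.Perm.sign (σ j) : ℂ)) *
      (if τ.symm (I 1) ≠ τ.symm (J 1) ∧ (fun j => σ j (τ.symm (I 1))) = I ∧
          (fun j => σ j (τ.symm (J 1))) = J then
        ∏ i ∈ (Finset.univ.erase (τ.symm (I 1))).erase (τ.symm (J 1)),
          (if σ 2 i = σ 0 i ∧ σ 3 i = σ 1 i then Y (σ 0 i, σ 1 i) else 0)
      else 0) := by
  have eτI : τ (τ.symm (I 1)) = I 1 := τ.apply_symm_apply _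
  have eτJ : τ (τ.symm (J 1)) = J 1 := τ.apply_symm_apply _
  by_cases hM : π (J 1) = J 0 ∧ I 1 ≠ J 1 ∧ π (I 1) = I 0
  swap
  · rw [if_neg hM, mul_zero, if_neg, mul_zero]
    rintro ⟨hpq, hI, hJ⟩
    have hI0 := congrFun hI 0
    have hJ0 := congrFun hJ 0
    simp only [h0, Equiv.Perm.mul_apply, eτI, eτJ] at hI0 hJ0
    exact hM ⟨hJ0, fun h => hpq (by rw [h]), hI0⟩
  rw [if_pos hM]
  obtain ⟨hJ0, h11, hI0⟩ := hM
  have h01 : I 0 ≠ J 0 := fun h => h11 (π.injective (hI0.trans (h.trans hJ0.symm)))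
  by_cases hE : ((I 2 = I 0 ∧ J 2 = J 0) ∨ (I 2 = J 0 ∧ J 2 = I 0)) ∧
      ((I 3 = I 1 ∧ J 3 = J 1) ∨ (I 3 = J 1 ∧ J 3 = I 1))
  swap
  · rw [if_neg hE, zero_mul, if_neg, mul_zero]
    rintro ⟨-, hI, hJ⟩
    have hI2 := congrFun hI 2
    have hJ2 := congrFun hJ 2
    have hI3 := congrFun hI 3
    have hJ3 := congrFun hJ 3
    simp only [h2, h3, Equiv.Perm.mul_apply, eτI, eτJ, hI0, hJ0] at hI2 hJ2 hI3 hJ3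
    exact hE ⟨(hdBlockEmb_rho_iff h01).mpr ⟨hI2, hJ2⟩, (hdBlockEmb_rho_iff h11).mpr ⟨hI3, hJ3⟩⟩
  rw [if_pos hE]
  obtain ⟨hI2, hJ2⟩ := (hdBlockEmb_rho_iff h01).mp hE.1
  obtain ⟨hI3, hJ3⟩ := (hdBlockEmb_rho_iff h11).mp hE.2
  have hP : τ.symm (I 1) ≠ τ.symm (J 1) ∧ (fun j => σ j (τ.symm (I 1))) = I ∧
      (fun j => σ j (τ.symm (J 1))) = J := by
    refine ⟨fun h => h11 (τ.symm.injective h), funext fun j => ?_, funext fun j => ?_⟩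
    · fin_cases j
      · simp [h0, Equiv.Perm.mul_apply, eτI, hI0]
      · simp [h1, eτI]
      · show σ 2 (τ.symm (I 1)) = I 2
        simpa only [h2, Equiv.Perm.mul_apply, eτI, hI0] using hI2
      · show σ 3 (τ.symm (I 1)) = I 3
        simpa only [h3, Equiv.Perm.mul_apply, eτI] using hI3
    · fin_cases j
      · simp [h0, Equiv.Perm.mul_apply, eτJ, hJ0]
      · simp [h1, eτJ]
      · show σ 2 (τ.symm (J 1)) = J 2
        simpa only [h2, Equiv.Perm.mul_apply, eτJ, hJ0] using hJ2
      · show σ 3 (τ.symm (J 1)) = J 3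
        simpa only [h3, Equiv.Perm.mul_apply, eτJ] using hJ3
  rw [if_pos hP]
  congr 1
  · -- the sign
    rw [Fin.prod_univ_four, h0, h1, h2, h3]
    simp only [Equiv.Perm.sign_mul, Units.val_mul, Int.cast_mul, hdBlockEmb_sign_rho h01,
      hdBlockEmb_sign_rho h11]
    have ha := hdBlockEmb_sign_mul_self (α := Fin n) π
    have hb := hdBlockEmb_sign_mul_self (α := Fin n) τ
    generalize ((Equiv.Perm.sign π : ℤˣ) : ℂ) = a at ha ⊢
    generalize ((Equiv.Perm.sign τ : ℤˣ) : ℂ) = b at hb ⊢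
    generalize (if I 2 = I 0 then (1 : ℂ) else -1) = s
    generalize (if I 3 = I 1 then (1 : ℂ) else -1) = t
    linear_combination (-(s * t * b ^ 4)) * ha + (-(s * t * (b ^ 2 + 1))) * hb
  · -- the product
    symm
    refine Finset.prod_equiv τ (fun i => ?_) (fun i hi => ?_)
    · simp only [Finset.mem_erase, Finset.mem_univ, and_true, Ne, Equiv.eq_symm_apply]
      tauto
    · simp only [Finset.mem_erase, Finset.mem_univ, and_true, Ne, Equiv.eq_symm_apply] at hi
      have hiI0 : π (τ i) ≠ I 0 := fun h => hi.2 (π.injective (h.trans hI0.symm))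
      have hiJ0 : π (τ i) ≠ J 0 := fun h => hi.1 (π.injective (h.trans hJ0.symm))
      rw [h0, h1, h2, h3]
      simp only [Equiv.Perm.mul_apply]
      rw [hdBlockEmb_rho_apply_of_ne hiI0 hiJ0, hdBlockEmb_rho_apply_of_ne hi.2 hi.1,
        if_pos ⟨rfl, rfl⟩]

/-! ### The stub -/

/-- **T1b — the Hessian sum of `HD_n` at the diagonal block point.**  For every matrix point
`Y` and indices `I, J : Fin 4 → Fin n`, the sum
`∑_σ (∏_j sgn σ_j) ∑_{p ≠ q, σ·p = I, σ·q = J} ∏_{i ∉ {p,q}} A(σ·i)` at the diagonal block point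
`A(K) = [K 2 = K 0] [K 3 = K 1] · Y (K 0, K 1)` equals
`n! · ε(I, J) · Hess(per_n)(Y)[(I 0, I 1), (J 0, J 1)]`, `ε(I, J) = ε₂ ε₃` the
diagonal-or-swapped sign pattern of the slots `2 / 0` and `3 / 1` (Gurvits 2004, Ex. 3.3 for the
block embedding; the Hessian entry of the permanent is `hess0_transl_perPoly`).  Proof: rewrite
the right-hand side by `hess0_transl_perPoly`, then `Fintype.sum_of_injective` with the
reindexing `hdBlockEmb_inj`, the vanishing `hdBlockEmb_vanish` off its image and the values
`hdBlockEmb_agree` on it; the `τ`-sum contributes `|𝔖_n| = n!`. [folklore] -/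
theorem stub_hdBlockEmb_sum_eq (n : ℕ) (Y : Fin n × Fin n → ℂ) (I J : Fin 4 → Fin n) :
    (∑ σ : Fin 4 → Equiv.Perm (Fin n), (∏ j, (Equiv.Perm.sign (σ j) : ℂ)) *
      ∑ p : Fin n, ∑ q : Fin n,
        if p ≠ q ∧ (fun j => σ j p) = I ∧ (fun j => σ j q) = J
        then ∏ i ∈ (Finset.univ.erase p).erase q,
          (fun K : Fin 4 → Fin n => if K 2 = K 0 ∧ K 3 = K 1 then Y (K 0, K 1) else 0)
            (fun j => σ j i)
        else 0) =
    (n.factorial : ℂ) *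
      (if ((I 2 = I 0 ∧ J 2 = J 0) ∨ (I 2 = J 0 ∧ J 2 = I 0)) ∧
          ((I 3 = I 1 ∧ J 3 = J 1) ∨ (I 3 = J 1 ∧ J 3 = I 1))
        then (if I 2 = I 0 then 1 else -1) * (if I 3 = I 1 then 1 else -1) else 0) *
      hess0 (transl Y (perPoly (Fin n) ℂ)) (I 0, I 1) (J 0, J 1) := by
  rw [hess0_transl_perPoly]
  beta_reduce
  have key := (Fintype.sum_of_injective _ (hdBlockEmb_inj n I J) _ _
    (fun x hx => hdBlockEmb_vanish n Y I J x.1 x.2.1 x.2.2 hx)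
    (fun y => hdBlockEmb_agree n Y I J y.1 y.2
      (![y.2 * y.1, y.1, (if I 2 = I 0 then 1 else Equiv.swap (I 0) (J 0)) * (y.2 * y.1),
          (if I 3 = I 1 then 1 else Equiv.swap (I 1) (J 1)) * y.1])
      rfl rfl rfl rfl)).symm
  simp only [Fintype.sum_prod_type] at key
  rw [Finset.sum_const, Finset.card_univ, Fintype.card_perm, Fintype.card_fin, nsmul_eq_mul,
    ← Finset.mul_sum, ← mul_assoc] at key
  refine Eq.trans ?_ key
  simp only [Finset.mul_sum]

end Summit.ValiantsHypothesis.ValiantsHypothesis.Theorems.DetQPDetqpThesis
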